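import Summits.KontsevichZagierPeriods.KontsevichZagierPeriods.Theses.IsogenyCertificates
import Summits.KontsevichZagierPeriods.KontsevichZagierPeriods.Theorems.XMapKernel.Negative.Core
import Summits.KontsevichZagierPeriods.KontsevichZagierPeriods.Theorems.IsogenyCertificatesXMapKernelStubSectorRepsExist
import Summits.KontsevichZagierPeriods.KontsevichZagierPeriods.Theorems.IsogenyCertificatesXMapKernelStubOrbitCollapse
import Summits.KontsevichZagierPeriods.KontsevichZagierPeriods.Theorems.IsogenyCertificatesXMapKernelStubDatumOfRatMult
import Summits.KontsevichZagierPeriods.KontsevichZagierPeriods.Theorems.IsogenyCertificatesXMapKernelStubHuberWustholzSplitting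
import Summits.KontsevichZagierPeriods.KontsevichZagierPeriods.Theorems.IsogenyCertificatesXMapKernelStubMultiplierRigidity
import Summits.KontsevichZagierPeriods.KontsevichZagierPeriods.Theorems.IsogenyCertificatesXMapKernelStubClassReduction
import Summits.KontsevichZagierPeriods.KontsevichZagierPeriods.Theorems.IsogenyCertificatesXMapKernelStubNonCMClass
import Summits.KontsevichZagierPeriods.KontsevichZagierPeriods.Theorems.IsogenyCertificatesXMapKernelStubCMClass
import Summits.KontsevichZagierPeriods.KontsevichZagierPeriods.Theorems.IsogenyCertificatesXMapKernelStubRadicalIndependence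
import Summits.KontsevichZagierPeriods.KontsevichZagierPeriods.Theorems.IsogenyCertificatesXMapKernelStubCellCollapse
import Literature.NumberTheory.Transcendental.TwoCurvePeriods
import Literature.NumberTheory.Transcendental.ManyCurvePeriods

/-!
# `XMapKernel` (stmt-KontsevichZagierPeriods-10663, route IsogenyCertificates) — line `isogeny-orbit-collapse`:
the REAL-PERIOD CELL of the crux, assembled (lead prover)

Conditionally on the tree's named fact `Literature.NumberTheory.Transcendental.HuberWustholzManyCurvePeriods` (Huber–Wüstholz 2022, Thm 15.3: the
`k`-curve dimension formula, i.e. Wüstholz's analytic subgroup theorem — unproved in the tree), this file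
assembles the line's landed stubs S (`…SectorRepsExist`, p86953), V (`…OrbitCollapse`, p89347), R-a
(`…DatumOfRatMult`, p91756), T (`…HuberWustholzSplitting`, p91000), R-b0 (`…MultiplierRigidity`, p92278), R-b1
(`…ClassReduction`, p93218), R-b2 (`…NonCMClass`, p94369), R-b3 (`…CMClass`, p94914), R-b4 (`…RadicalIndependence`,
p92767) and C (`…CellCollapse`, p95059) into:

* `realPeriodIndependence` — the full real periods `Ω(A,B) = ∫_{x³+Ax+B>0} dx/√(x³+Ax+B)` of pairwise
  x-rational-isogeny-UNRELATED nonsingular integral cubics are `ℚ`-linearly independent;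
* `realPeriodCellKernel` — **the real-period cell of `XMapKernel`**: every formal `ℤ`-combination of the
  sector's representations `[{P>0}, a/√P]` (`a ∈ ℚ`) with value `0` lies in the crux's enlarged move group
  `closure gens` (moves ∪ x-map relators) — WITHOUT `XMapPeriodTransfer`, by relators + rule (1b) only;
* `xMapKernel_iff_reduction` — given the cell, the crux `XMapKernel` is EQUIVALENT to its off-cell
  remainder K (`stub_reductionToRealPeriodSector` of the line's skeleton: every kernel element is congruent
  modulo `closure gens` to an element of the real-period sector), the GPC-strength statement that the line
  leaves open (Disproof F1: modulo `XMapPeriodTransfer`, K ↔ `KZKernelConjecture` ↔ the summit).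

No statement of the tree is changed; theorems only.
-/

noncomputable section

namespace Summit.KontsevichZagierPeriods.IsogenyCertificates.XMapKernelRealPeriodCell

open scoped BigOperators
open Literature.NumberTheory.Transcendental
open Summit.KontsevichZagierPeriods.KontsevichZagierPeriods.Theses.IsogenyCertificates
open Summit.KontsevichZagierPeriods.IsogenyCertificates.XMapKernelStubs
open Set MeasureTheory

/-- **Real-period independence (datum form), conditional on Huber–Wüstholz.** The full real periods of
pairwise x-rational-isogeny-unrelated nonsingular integral short Weierstrass cubics are `ℚ`-linearly independent.
Assembled from R-b1 (class reduction over the fact), R-b2/R-b3 (non-CM / CM class, over R-b0 rigidity and R-b4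
radical independence) and the contrapositive of R-a (rational lattice multiplier ⇒ datum).
[cite: HuberWustholz2022, Thm. 15.3 (1)] -/
theorem realPeriodIndependence : Literature.NumberTheory.Transcendental.HuberWustholzManyCurvePeriods → ∀ (k : ℕ) (A B : Fin k → ℤ) (q : Fin k → ℚ), (∀ i, 4 * A i ^ 3 + 27 * B i ^ 2 ≠ 0) → (∀ i j, i ≠ j → ¬ ∃ (f g : Polynomial ℚ) (c : ℚ), Polynomial.derivative f * g - f * Polynomial.derivative g ≠ 0 ∧ Polynomial.C (c ^ 2) * g * (f ^ 3 + Polynomial.C (A j : ℚ) * f * g ^ 2 + Polynomial.C (B j : ℚ) * g ^ 3) = (Polynomial.X ^ 3 + Polynomial.C (A i : ℚ) * Polynomial.X + Polynomial.C (B i : ℚ)) * (Polynomial.derivative f * g - f * Polynomial.derivative g) ^ 2) → ∑ i, (q i : ℝ) * (∫ x in {x : Fin 1 → ℝ | 0 < x 0 ^ 3 + (A i : ℝ) * x 0 + (B i : ℝ)}, 1 / Real.sqrt (x 0 ^ 3 + (A i : ℝ) * x 0 + (B i : ℝ))) = 0 → ∀ i, q i = 0 := by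
  intro hHW
  classical
  -- independence modulo RATIONAL lattice multipliers, from R-b0 … R-b4
  have hmod : ∀ (k : ℕ) (A B : Fin k → ℤ) (q : Fin k → ℚ), (∀ i, 4 * A i ^ 3 + 27 * B i ^ 2 ≠ 0) →
      (∀ i j, i ≠ j → ¬ ∃ (L L' : PeriodPair) (c : ℚ), L.g₂ = -4 * (A i : ℂ) ∧ L.g₃ = -4 * (B i : ℂ) ∧
        L'.g₂ = -4 * (A j : ℂ) ∧ L'.g₃ = -4 * (B j : ℂ) ∧ c ≠ 0 ∧ ∀ l ∈ L.lattice, (c : ℂ) * l ∈ L'.lattice) →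
      ∑ i, (q i : ℝ) * (∫ x in {x : Fin 1 → ℝ | 0 < x 0 ^ 3 + (A i : ℝ) * x 0 + (B i : ℝ)},
        1 / Real.sqrt (x 0 ^ 3 + (A i : ℝ) * x 0 + (B i : ℝ))) = 0 → ∀ i, q i = 0 := by
    intro k A B q hns hnrm hsum i
    obtain ⟨L₀, h2, h3, hclass⟩ := ClassReduction.stub_classReduction hHW k A B q hns hsum i
    set S : Finset (Fin k) := Finset.univ.filter (fun j => ∃ (L' : PeriodPair) (α : ℂ),
      L'.g₂ = -4 * (A j : ℂ) ∧ L'.g₃ = -4 * (B j : ℂ) ∧ α ≠ 0 ∧ ∀ l ∈ L₀.lattice, α * l ∈ L'.lattice) with hSdef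
    have hS : ∀ j, j ∈ S ↔ ∃ (L' : PeriodPair) (α : ℂ),
        L'.g₂ = -4 * (A j : ℂ) ∧ L'.g₃ = -4 * (B j : ℂ) ∧ α ≠ 0 ∧ ∀ l ∈ L₀.lattice, α * l ∈ L'.lattice := by
      intro j
      simp [hSdef]
    have hsumS := hclass S hS
    have hmem : ∀ j ∈ S, ∃ (L' : PeriodPair) (α : ℂ),
        L'.g₂ = -4 * (A j : ℂ) ∧ L'.g₃ = -4 * (B j : ℂ) ∧ α ≠ 0 ∧ ∀ l ∈ L₀.lattice, α * l ∈ L'.lattice :=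
      fun j hj => (hS j).1 hj
    have hnrmS : ∀ i ∈ S, ∀ j ∈ S, i ≠ j → ¬ ∃ (L L' : PeriodPair) (c : ℚ), L.g₂ = -4 * (A i : ℂ) ∧
        L.g₃ = -4 * (B i : ℂ) ∧ L'.g₂ = -4 * (A j : ℂ) ∧ L'.g₃ = -4 * (B j : ℂ) ∧ c ≠ 0 ∧
        ∀ l ∈ L.lattice, (c : ℂ) * l ∈ L'.lattice :=
      fun i _ j _ hij => hnrm i j hij
    have hg₂ : ∃ q₀ : ℚ, (q₀ : ℂ) = L₀.g₂ := ⟨-4 * A i, by rw [h2]; push_cast; ring⟩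
    have hg₃ : ∃ q₀ : ℚ, (q₀ : ℂ) = L₀.g₃ := ⟨-4 * B i, by rw [h3]; push_cast; ring⟩
    have hi : i ∈ S := (hS i).2 ⟨L₀, 1, h2, h3, one_ne_zero, fun l hl => by simpa using hl⟩
    by_cases hCM : L₀.HasCM
    · exact CMClass.stub_cmClass MultiplierRigidity.stub_multiplierRigidity
        RadicalIndependence.stub_radicalIndependence k A B q S L₀ hns hg₂ hg₃ hCM hmem hnrmS hsumS i hi
    · exact NonCMClass.stub_nonCMClass MultiplierRigidity.stub_multiplierRigidity
        RadicalIndependence.stub_radicalIndependence k A B q S L₀ hns hg₂ hg₃ hCM hmem hnrmS hsumS i hi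
  -- datum form, by the contrapositive of R-a
  intro k A B q hns hnd hsum
  refine hmod k A B q hns ?_ hsum
  intro i j hij hrat
  obtain ⟨L, L', c, h1, h2, h3, h4, hc, hmul⟩ := hrat
  exact hnd i j hij
    (DatumOfRatMult.stub_datumOfRatMult (A i) (B i) (A j) (B j) (hns i) (hns j) L L' c h1 h2 h3 h4 hc hmul)

/-- **The real-period cell of `XMapKernel`, conditional on Huber–Wüstholz.** Every element of the closure
of the real-period sector generators `[{x³+Ax+B>0}, a/√(x³+Ax+B)]` (`(A,B) ∈ ℤ²` nonsingular, `a ∈ ℚ`) with value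
`0` lies in `closure gens`, the subgroup generated by the four KZ moves and the x-map period relators — the
line's lever C fed with S (reps exist), V (orbit collapse) and `realPeriodIndependence`. No use of
`XMapPeriodTransfer`. [cite: KontsevichZagier2001, §1.2] -/
theorem realPeriodCellKernel : Literature.NumberTheory.Transcendental.HuberWustholzManyCurvePeriods → ∀ c ∈ AddSubgroup.closure {d : Literature.NumberTheory.Transcendental.KZ.FormalRep | ∃ (A B : ℤ) (a : ℚ) (r : Literature.NumberTheory.Transcendental.KZ.IntegralRep 1), 4 * A ^ 3 + 27 * B ^ 2 ≠ 0 ∧ r.domain = {x | 0 < x 0 ^ 3 + (A : ℝ) * x 0 + (B : ℝ)} ∧ Set.EqOn r.integrand (fun x => (a : ℝ) / Real.sqrt (x 0 ^ 3 + (A : ℝ) * x 0 + (B : ℝ))) r.domain ∧ d = Literature.NumberTheory.Transcendental.KZ.of r}, Literature.NumberTheory.Transcendental.KZ.eval c = 0 → c ∈ AddSubgroup.closure Summit.KontsevichZagierPeriods.XMapKernel.Negative.gens := fun hHW =>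
  CellCollapse.stub_cellCollapse SectorRepsExist.stub_sectorRepsExist OrbitCollapse.stub_orbitCollapse
    (realPeriodIndependence hHW)

/-- **What the line leaves open.** Conditionally on Huber–Wüstholz, the crux `XMapKernel` is EQUIVALENT to
its off-cell remainder K ("every kernel element is congruent modulo `closure gens` to an element of the
real-period sector") — the GPC-strength stub `stub_reductionToRealPeriodSector` of the line's skeleton:
`→` with the sector element `0`; `←` by the cell theorem and soundness `closure_gens_le_ker_eval`. [folklore] -/
theorem xMapKernel_iff_reduction : Literature.NumberTheory.Transcendental.HuberWustholzManyCurvePeriods → (Summit.KontsevichZagierPeriods.KontsevichZagierPeriods.Theses.IsogenyCertificates.XMapKernel ↔ ∀ c : Literature.NumberTheory.Transcendental.KZ.FormalRep, Literature.NumberTheory.Transcendental.KZ.eval c = 0 → ∃ c' ∈ AddSubgroup.closure {d : Literature.NumberTheory.Transcendental.KZ.FormalRep | ∃ (A B : ℤ) (a : ℚ) (r : Literature.NumberTheory.Transcendental.KZ.IntegralRep 1), 4 * A ^ 3 + 27 * B ^ 2 ≠ 0 ∧ r.domain = {x | 0 < x 0 ^ 3 + (A : ℝ) * x 0 + (B :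 ℝ)} ∧ Set.EqOn r.integrand (fun x => (a : ℝ) / Real.sqrt (x 0 ^ 3 + (A : ℝ) * x 0 + (B : ℝ))) r.domain ∧ d = Literature.NumberTheory.Transcendental.KZ.of r}, c - c' ∈ AddSubgroup.closure Summit.KontsevichZagierPeriods.XMapKernel.Negative.gens) := by
  intro hHW
  constructor
  · intro hX c hc
    refine ⟨0, AddSubgroup.zero_mem _, ?_⟩
    rw [sub_zero]
    exact (Summit.KontsevichZagierPeriods.XMapKernel.Negative.crux_iff.1 hX) c hc
  · intro hK
    rw [Summit.KontsevichZagierPeriods.XMapKernel.Negative.crux_iff]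
    intro c hc
    obtain ⟨c', hc', hcc'⟩ := hK c hc
    have hdiff : KZ.eval (c - c') = 0 :=
      AddMonoidHom.mem_ker.1 (Summit.KontsevichZagierPeriods.XMapKernel.Negative.closure_gens_le_ker_eval hcc')
    have hc'0 : KZ.eval c' = 0 := by
      rw [map_sub, hc, zero_sub, neg_eq_zero] at hdiff
      exact hdiff
    have hc'mem := realPeriodCellKernel hHW c' hc' hc'0
    have : c = (c - c') + c' := by abel
    rw [this]
    exact AddSubgroup.add_mem _ hcc' hc'mem

end Summit.KontsevichZagierPeriods.IsogenyCertificates.XMapKernelRealPeriodCell
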